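import Literature.NumberTheory.LFunctions.WeilExplicitArchTermProofs
import Literature.NumberTheory.LFunctions.WeilMellinInversion
import Literature.NumberTheory.LFunctions.KadiriGammaRemainder
import Literature.NumberTheory.LFunctions.RiemannSiegelStirling
import HarnessLib

/-!
# Growth of the archimedean term of the explicit formula under modulation

Topic `Literature/NumberTheory/LFunctions`. Everything in this file is PROVED (no definitions, no
named facts).

For a Weil test `g` (`Literature.NumberTheory.LFunctions.IsWeilTest`: smooth, compactly supported)
and a real height `T`, the modulated test `g_T(t) = g(t) e^{-iTt}` has transform
`ĝ_T(1/2 + it) = ĝ(1/2 + i(t - T))` on the critical line (modulation is a translation along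
the line), so the archimedean integral of the Guinand–Weil explicit formula
(`Literature.NumberTheory.LFunctions.weilArchIntegral`,
`∫ ĝ_T(1/2 + it) Re ψ(1/4 + it/2) dt` with `ψ = Γ'/Γ`) is `∫ ĝ(1/2 + i(t - T)) Re ψ(1/4 + it/2) dt`.
By Stirling's formula on the vertical line `Re w = 1/4`
(`Literature.NumberTheory.LFunctions.abs_re_digamma_vertical_sub_log_le`,
`|Re ψ(1/4 + iv) - log v| ≤ K(1/4)/v²` for `v ≥ 1`) and the crude bound
`|Re ψ(1/4 + iτ/2)| ≤ log(3 + |τ|) + 12` (`KadiriGamma.abs_re_digamma_le`), the weight satisfies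

  `|Re ψ(1/4 + iτ/2) - log |T|| ≤ K(1/4) + 17 + log(1 + |τ - T|)`   (`|T| ≥ 2`, all `τ`)

(`abs_re_digamma_quarter_sub_log_abs_le`), and since `ĝ` decays like `(1 + u²)^{-2}` on the line,

  `|∫ ĝ(1/2 + i(t - T)) Re ψ(1/4 + it/2) dt - (2π g(0)) · log |T|| ≤ C(g)`   (`|T| ≥ 2`)

(`exists_norm_integral_weilMellin_shift_mul_re_digamma_sub_le`; `∫ ĝ(1/2 + iu) du = 2π g(0)` is
Fourier inversion, `Literature.NumberTheory.LFunctions.integral_weilMellin_vertical`), i.e.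
`weilArchIntegral g_T = 2π g(0) log|T| + O_g(1)` (`exists_norm_weilArchIntegral_modulate_sub_le`).
This is the main term `(1/2π) log T` per unit frequency of the Riemann–von Mangoldt density seen from
the test-function side; it drives lower and upper bounds for the local mass of any positive measure
representing the Weil functional on a window (e.g. the local counting law for spectral witnesses).

## References

* E. Bombieri, *Remarks on Weil's quadratic functional in the theory of prime numbers I*, Rend. Mat.
  Acc. Lincei (9) 11 (2000), §2 (archimedean term in digamma form).
* H. Iwaniec, E. Kowalski, *Analytic Number Theory* (2004), (5.44)–(5.45), §5.5.
-/

noncomputable section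

open Complex Filter Set MeasureTheory
open scoped Real Topology

namespace Literature.NumberTheory.LFunctions

variable {g : ℝ → ℂ}

/-! ## The digamma weight `Re ψ(1/4 + iτ/2)` against `log |T|` -/

/-- Stirling on the line `Re w = 1/4`, symmetric form: for `|τ| ≥ 2`,
`|Re ψ(1/4 + iτ/2) - log(|τ|/2)| ≤ K(1/4)` with `K = stirlingVertRate` (evenness of `Re ψ` in the
imaginary part, `KadiriGamma.re_digamma_neg_im`, and `abs_re_digamma_vertical_sub_log_le`).
[folklore] -/
theorem abs_re_digamma_quarter_sub_log_half_le {τ : ℝ} (hτ : 2 ≤ |τ|) :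
    |(digamma (1 / 4 + τ / 2 * I)).re - Real.log (|τ| / 2)| ≤ stirlingVertRate (1 / 4) := by
  have hK : 0 ≤ stirlingVertRate (1 / 4) := by unfold stirlingVertRate; positivity
  have hv : 1 ≤ |τ| / 2 := by linarith
  have h := abs_re_digamma_vertical_sub_log_le (σ := 1 / 4) (u := |τ| / 2) (by norm_num) hv
  have hdiv : stirlingVertRate (1 / 4) / (|τ| / 2) ^ 2 ≤ stirlingVertRate (1 / 4) :=
    div_le_self hK (by nlinarith)
  -- identify `Re ψ(1/4 + iτ/2)` with `Re ψ(1/4 + i|τ|/2)`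
  have heq : (digamma (1 / 4 + τ / 2 * I)).re =
      (digamma ((((1 / 4 : ℝ)) : ℂ) + ((|τ| / 2 : ℝ) : ℂ) * I)).re := by
    rcases le_or_gt 0 τ with h0 | h0
    · rw [abs_of_nonneg h0]; congr 2; push_cast; ring
    · rw [abs_of_neg h0, ← KadiriGamma.re_digamma_neg_im]
      congr 2; push_cast; ring
  rw [heq]
  exact h.trans hdiv

/-- `Re ψ(1/4 + iτ/2)` as the value of the weight `y ↦ Re ψ((1/2 + iy)/2)` of
`KadiriGamma.abs_re_digamma_le`. [folklore] -/
theorem abs_re_digamma_quarter_le_log (τ : ℝ) :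
    |(digamma (1 / 4 + τ / 2 * I)).re| ≤ Real.log (3 + |τ|) + 12 := by
  have h := KadiriGamma.abs_re_digamma_le τ
  have e : ((((1 / 2 : ℝ)) : ℂ) + τ * I) / 2 = 1 / 4 + τ / 2 * I := by push_cast; ring
  rwa [e] at h

/-- **The digamma weight is `log |T|` up to a logarithm of the distance**: for `|T| ≥ 2` and every
real `τ`, `|Re ψ(1/4 + iτ/2) - log |T|| ≤ K(1/4) + 17 + log(1 + |τ - T|)`. Near the real axis
(`|τ| < 2`) this is the crude bound `log 5 + 12` plus `log |T| ≤ log 2 + log(1 + |τ - T|)`; for `|τ| ≥ 2`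
it is Stirling plus `|log(|τ|/(2|T|))| ≤ log 4 + log(1 + |τ - T|)`. [folklore] -/
theorem abs_re_digamma_quarter_sub_log_abs_le {T : ℝ} (hT : 2 ≤ |T|) (τ : ℝ) :
    |(digamma (1 / 4 + τ / 2 * I)).re - Real.log (|T|)| ≤
      stirlingVertRate (1 / 4) + 17 + Real.log (1 + |τ - T|) := by
  have hK : 0 ≤ stirlingVertRate (1 / 4) := by unfold stirlingVertRate; positivity
  set u : ℝ := τ - T with hu
  have hτu : τ = u + T := by rw [hu]; ring
  have hT0 : 0 < |T| := by linarith
  have hlogT0 : 0 ≤ Real.log |T| := Real.log_nonneg (by linarith)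
  have hL0 : 0 ≤ Real.log (1 + |u|) := Real.log_nonneg (by linarith [abs_nonneg u])
  have hlog2 : Real.log 2 ≤ 1 := by
    have := Real.log_le_sub_one_of_pos (by norm_num : (0 : ℝ) < 2); linarith
  have hlog4 : Real.log 4 ≤ 3 := by
    have := Real.log_le_sub_one_of_pos (by norm_num : (0 : ℝ) < 4); linarith
  rcases lt_or_ge |τ| 2 with hsmall | hbig
  · -- near the real axis
    have h1 := abs_re_digamma_quarter_le_log τ
    have h2 : Real.log (3 + |τ|) ≤ 4 := by
      have := Real.log_le_sub_one_of_pos (by positivity : (0 : ℝ) < 3 + |τ|); linarith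
    have h3 : Real.log |T| ≤ Real.log 2 + Real.log (1 + |u|) := by
      rw [← Real.log_mul (by norm_num) (by positivity)]
      refine Real.log_le_log hT0 ?_
      have : |T| ≤ |τ| + |u| := by
        have := abs_sub (u + T) u
        rw [add_sub_cancel_left] at this
        rw [hτu]; linarith [abs_sub_abs_le_abs_sub (u + T) u, abs_add_le u T, abs_neg u,
          show |T| = |(u + T) - u| by ring_nf]
      linarith
    rw [abs_le]
    constructor
    · nlinarith [neg_abs_le (digamma (1 / 4 + τ / 2 * I)).re]
    · nlinarith [le_abs_self (digamma (1 / 4 + τ / 2 * I)).re]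
  · -- Stirling range
    have h1 := abs_re_digamma_quarter_sub_log_half_le hbig
    have hτ0 : 0 < |τ| := by linarith
    -- `|log(|τ|/2) - log|T|| ≤ log 4 + log(1+|u|)`
    have hratio : Real.log (|τ| / 2) - Real.log |T| = Real.log (|τ| / (2 * |T|)) := by
      rw [Real.log_div hτ0.ne' (by norm_num), Real.log_div hτ0.ne' (by positivity),
        Real.log_mul (by norm_num) hT0.ne']
      ring
    have hup : Real.log (|τ| / (2 * |T|)) ≤ Real.log (1 + |u|) := by
      refine Real.log_le_log (by positivity) ?_
      rw [div_le_iff₀ (by positivity)]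
      have h1T : 1 ≤ |T| := by linarith
      have : |τ| ≤ |u| + |T| := by rw [hτu]; exact abs_add_le u T
      nlinarith [abs_nonneg u]
    have hdown : -(Real.log 4 + Real.log (1 + |u|)) ≤ Real.log (|τ| / (2 * |T|)) := by
      rw [← Real.log_mul (by norm_num) (by positivity), ← Real.log_inv]
      refine Real.log_le_log (by positivity) ?_
      rw [le_div_iff₀ (by positivity)]
      -- `2|T| ≤ 4 (1 + |u|) |τ|`
      have hTle : |T| ≤ |u| + |τ| := by
        have := abs_sub_abs_le_abs_sub T (-u)
        have e : T - -u = u + T := by ring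
        rw [e, ← hτu, abs_neg] at this
        linarith
      rcases le_or_gt |u| (|T| / 2) with hcase | hcase
      · have : |T| / 2 ≤ |τ| := by linarith
        have hpos : (0 : ℝ) < 4 * (1 + |u|) := by positivity
        calc (4 * (1 + |u|))⁻¹ * (2 * |T|) = (2 * |T|) / (4 * (1 + |u|)) := by
              rw [inv_mul_eq_div]
          _ ≤ (2 * |T|) / 4 := by
              apply div_le_div_of_nonneg_left (by positivity) (by norm_num)
              linarith [abs_nonneg u]
          _ = |T| / 2 := by ring
          _ ≤ |τ| := this
      · have hpos : (0 : ℝ) < 4 * (1 + |u|) := by positivity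
        calc (4 * (1 + |u|))⁻¹ * (2 * |T|) = (2 * |T|) / (4 * (1 + |u|)) := by
              rw [inv_mul_eq_div]
          _ ≤ 2 := by
              rw [div_le_iff₀ hpos]; nlinarith [abs_nonneg u]
          _ ≤ |τ| := hbig
    rw [abs_le] at h1 ⊢
    constructor
    · linarith [h1.1]
    · linarith [h1.2]

/-- The weight is continuous in `τ`. [folklore] -/
theorem continuous_re_digamma_quarter_half :
    Continuous fun τ : ℝ => (digamma (1 / 4 + τ / 2 * I)).re := by
  have h := continuous_re_digamma_vertical (σ := 1 / 4) (by norm_num)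
  have h' : Continuous fun τ : ℝ => (digamma (((1 / 4 : ℝ) : ℂ) + ((τ / 2 : ℝ) : ℂ) * I)).re :=
    h.comp (continuous_id.div_const 2)
  refine h'.congr fun τ => ?_
  congr 2
  push_cast
  ring

/-! ## The main term `2π g(0) log |T|` of the shifted archimedean integral -/

/-- `u ↦ ĝ(1/2 + iu) L(u)` is integrable for a continuous weight of linear growth. [folklore] -/
theorem integrable_weilMellin_half_mul_of_linear (hg : IsWeilTest g) {L : ℝ → ℝ}
    (hL : Continuous L) {C : ℝ} (hC : ∀ u, |L u| ≤ C * (1 + |u|)) :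
    Integrable fun u : ℝ => weilMellin g (1 / 2 + u * I) * (L u : ℂ) := by
  have h := integrable_mul_weilMellin_vertical_of_norm_le_linear hg (1 / 2)
    (F := fun u => (L u : ℂ)) (Complex.continuous_ofReal.comp hL) (C := C)
    (fun u => by rw [Complex.norm_real, Real.norm_eq_abs]; exact hC u)
  refine (h.congr (Eventually.of_forall fun u => ?_))
  simp only
  push_cast
  ring

/-- **Main term of the shifted archimedean integral.** For a Weil test `g` there is `C` with
`|∫ ĝ(1/2 + i(t - T)) Re ψ(1/4 + it/2) dt - 2π g(0) log |T|| ≤ C` for all `|T| ≥ 2`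
(`C = ∫ |ĝ(1/2 + iu)| (K(1/4) + 17 + log(1 + |u|)) du`). [folklore] -/
theorem exists_norm_integral_weilMellin_shift_mul_re_digamma_sub_le (hg : IsWeilTest g) :
    ∃ C : ℝ, ∀ T : ℝ, 2 ≤ |T| →
      ‖(∫ t : ℝ, weilMellin g (1 / 2 + ((t - T : ℝ) : ℂ) * I) *
            ((digamma (1 / 4 + t / 2 * I)).re : ℂ)) -
          2 * π * g 0 * Real.log |T|‖ ≤ C := by
  set A : ℝ := stirlingVertRate (1 / 4) + 17 with hA
  have hK : 0 ≤ stirlingVertRate (1 / 4) := by unfold stirlingVertRate; positivity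
  have hA0 : 0 ≤ A := by rw [hA]; positivity
  set Φ : ℝ → ℂ := fun u => weilMellin g (1 / 2 + u * I) with hΦ
  -- the `T`-independent majorant
  have hmaj : Integrable fun u : ℝ => ‖Φ u‖ * (A + Real.log (1 + |u|)) := by
    have h := integrable_weilMellin_half_mul_of_linear hg (L := fun u => A + Real.log (1 + |u|))
      (continuous_const.add (Continuous.log (by fun_prop) fun u => by positivity)) (C := A + 1)
      (fun u => by
        have h0 : 0 ≤ Real.log (1 + |u|) := Real.log_nonneg (by linarith [abs_nonneg u])
        have h1 : Real.log (1 + |u|) ≤ 1 + |u| := by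
          have := Real.log_le_sub_one_of_pos (by positivity : (0 : ℝ) < 1 + |u|)
          linarith [abs_nonneg u]
        rw [abs_of_nonneg (by positivity)]
        nlinarith [abs_nonneg u])
    refine (h.norm.congr (Eventually.of_forall fun u => ?_))
    have h0 : 0 ≤ A + Real.log (1 + |u|) :=
      add_nonneg hA0 (Real.log_nonneg (by linarith [abs_nonneg u]))
    simp only [norm_mul, Complex.norm_real, Real.norm_eq_abs, abs_of_nonneg h0, hΦ]
  refine ⟨∫ u : ℝ, ‖Φ u‖ * (A + Real.log (1 + |u|)), fun T hT => ?_⟩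
  set ψr : ℝ → ℝ := fun t => (digamma (1 / 4 + t / 2 * I)).re with hψr
  -- `2π g(0) = ∫ ĝ(1/2 + iu) du`
  have hg0 : 2 * π * g 0 = ∫ u : ℝ, Φ u := by
    have h := integral_weilMellin_vertical hg (1 / 2)
    have e : (((1 / 2 : ℝ)) : ℂ) = 1 / 2 := by push_cast; ring
    simp_rw [e] at h
    rw [h]
  -- integrability of the two pieces (in the variable `u = t - T`)
  have hI1 : Integrable fun u : ℝ => Φ u * (ψr (u + T) : ℂ) := by
    refine integrable_weilMellin_half_mul_of_linear hg (L := fun u => ψr (u + T))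
      (continuous_re_digamma_quarter_half.comp (continuous_id.add continuous_const))
      (C := Real.log (3 + |T|) + 14) (fun u => ?_)
    have h1 := abs_re_digamma_quarter_le_log (u + T)
    have h2 : Real.log (3 + |u + T|) ≤ Real.log (3 + |T|) + Real.log (1 + |u|) := by
      rw [← Real.log_mul (by positivity) (by positivity)]
      refine Real.log_le_log (by positivity) ?_
      nlinarith [abs_add_le u T, abs_nonneg u, abs_nonneg T]
    have h3 : Real.log (1 + |u|) ≤ |u| := by
      have := Real.log_le_sub_one_of_pos (by positivity : (0 : ℝ) < 1 + |u|); linarith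
    have h4 : 0 ≤ Real.log (3 + |T|) := Real.log_nonneg (by linarith [abs_nonneg T])
    simp only [hψr] at h1 ⊢
    nlinarith [abs_nonneg u, abs_nonneg ((digamma (1 / 4 + ↑(u + T) / 2 * I)).re)]
  have hI2 : Integrable fun u : ℝ => Φ u * ((Real.log |T| : ℝ) : ℂ) := by
    have h := (integrable_weilMellin_vertical hg (1 / 2)).mul_const ((Real.log |T| : ℝ) : ℂ)
    refine h.congr (Eventually.of_forall fun u => ?_)
    simp only [hΦ]
    push_cast
    ring_nf
  -- shift the integral to the variable `u`
  have hshift : (∫ t : ℝ, weilMellin g (1 / 2 + ((t - T : ℝ) : ℂ) * I) * (ψr t : ℂ)) =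
      ∫ u : ℝ, Φ u * (ψr (u + T) : ℂ) := by
    rw [← integral_sub_right_eq_self (fun u => Φ u * (ψr (u + T) : ℂ)) T]
    refine integral_congr_ae (Eventually.of_forall fun t => ?_)
    simp only [hΦ, sub_add_cancel]
  have hmain : (∫ t : ℝ, weilMellin g (1 / 2 + ((t - T : ℝ) : ℂ) * I) * (ψr t : ℂ)) -
      2 * π * g 0 * Real.log |T| = ∫ u : ℝ, Φ u * ((ψr (u + T) - Real.log |T| : ℝ) : ℂ) := by
    rw [hshift, hg0, ← integral_mul_const, ← integral_sub hI1 hI2]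
    refine integral_congr_ae (Eventually.of_forall fun u => ?_)
    push_cast
    ring
  rw [hmain]
  calc ‖∫ u : ℝ, Φ u * ((ψr (u + T) - Real.log |T| : ℝ) : ℂ)‖
      ≤ ∫ u : ℝ, ‖Φ u * ((ψr (u + T) - Real.log |T| : ℝ) : ℂ)‖ := norm_integral_le_integral_norm _
    _ ≤ ∫ u : ℝ, ‖Φ u‖ * (A + Real.log (1 + |u|)) := by
        refine integral_mono_of_nonneg (Eventually.of_forall fun _ => norm_nonneg _) hmaj
          (Eventually.of_forall fun u => ?_)
        dsimp only
        rw [norm_mul, Complex.norm_real, Real.norm_eq_abs]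
        refine mul_le_mul_of_nonneg_left ?_ (norm_nonneg _)
        have h := abs_re_digamma_quarter_sub_log_abs_le hT (u + T)
        simp only [add_sub_cancel_right] at h
        simpa [hψr, hA] using h

/-! ## The modulated test -/

/-- **Growth of the archimedean integral under modulation**: for a Weil test `g` there is `C` with
`|weilArchIntegral (g_T) - 2π g(0) log |T|| ≤ C` for all `|T| ≥ 2`, where `g_T(t) = g(t) e^{-iTt}`
(whose transform on the critical line is the translate `ĝ(1/2 + i(t - T))`). [folklore] -/
theorem exists_norm_weilArchIntegral_modulate_sub_le (hg : IsWeilTest g) :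
    ∃ C : ℝ, ∀ T : ℝ, 2 ≤ |T| →
      ‖weilArchIntegral (fun t => g t * cexp (((-(T * t) : ℝ) : ℂ) * I)) -
          2 * π * g 0 * Real.log |T|‖ ≤ C := by
  obtain ⟨C, hC⟩ := exists_norm_integral_weilMellin_shift_mul_re_digamma_sub_le hg
  refine ⟨C, fun T hT => ?_⟩
  -- modulation translates the transform along the critical line
  have hmod : ∀ t : ℝ, weilMellin (fun t => g t * cexp (((-(T * t) : ℝ) : ℂ) * I)) (1 / 2 + t * I) =
      weilMellin g (1 / 2 + ((t - T : ℝ) : ℂ) * I) := by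
    intro t
    unfold weilMellin
    congr 1 with x
    beta_reduce
    rw [mul_assoc, ← Complex.exp_add]
    congr 2
    push_cast
    ring
  have h := hC T hT
  unfold weilArchIntegral
  simp_rw [hmod]
  exact h

end Literature.NumberTheory.LFunctions

end
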